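import Literature.Analysis.FluidPDE.LeiZhang2011SlabSetting
import Literature.Analysis.FluidPDE.LeiZhang2011MeanValueTenThirds
import Literature.Analysis.FluidPDE.SignedPowers
import HarnessLib

/-!
# Lei–Zhang 2011, Theorem 1.4 — the local bound on the swirl from the mean value inequality

Analysis/FluidPDE **proofs file** (theorems only: no definitions, no named facts, no `sorry`)
on the discharge path of `Literature.Analysis.FluidPDE.LeiZhang2011_regularity_bmoStream`
(Z. Lei, Q. S. Zhang, J. Funct. Anal. 261 (2011) = arXiv:1011.5066, **Theorem 1.4**). In the
proof of Theorem 1.4 the paper bounds `Γ = r v^θ` "by the assumption on initial value and the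
maximum principle" (p. 12). For a Leray–Hopf weak solution this maximum principle is available
only along epochs of regularity; near a (potential) singular time the tree instead bounds `Γ`
**locally** by the local maximum estimate (2.6) of §2 — whose constant depends only on the `BMO`
bound of the stream function, not on the size of the velocity — started at the energy exponent
`10/3` (`LeiZhang2011.meanValue_inequality_tenThirds`):

* `LeiZhang2011.abs_family` — the admissible power family `H_m = |·|^m`, `s_m = |·|^{m/2−1}·`
  (`SignedPowers`);
* `LeiZhang2011.abs_le_of_setting_tenThirds` — in the setting at radius `ρ`,
  `|F(s, x)| ≤ C(C_B) ρ^{-3/2} ‖F‖_{L^{10/3}((−ρ²,0]×B̄(0,ρ))}` for `s ∈ (−ρ²/4, 0)`,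
  `x ∈ B(0, ρ/2)` (mean value inequality for `|F|` and continuity);
* `LeiZhang2011.abs_le_of_slab` — the same for the swirl-type quantity `f` of
  `bundle_of_swirl_setting_slab` on a slab `[τ − R², τ]`:
  `|f(t, x)| ≤ C(C_B) R^{-3/2} ‖f‖_{L^{10/3}((τ−R²,τ]×B̄(0,R))}` for `t ∈ (τ − R²/4, τ)`,
  `x ∈ B(0, R/2)`.

## References

* Z. Lei, Q. S. Zhang, J. Funct. Anal. 261 (2011) = arXiv:1011.5066, §2 (2.6) and §4 (proof of
  Thm. 1.4, pp. 12–13). [LeiZhang2011]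
-/

noncomputable section

open MeasureTheory Set Function Filter Metric intervalIntegral InnerProductSpace
open _root_.Topology
open scoped InnerProductSpace RealInnerProductSpace NNReal ENNReal Laplacian

namespace Literature.Analysis.FluidPDE

namespace LeiZhang2011

open Literature.Analysis.FunctionSpaces

/-! ### The power family `|·|^m` -/

/-- **The admissible power family of `|·|`** for `meanValue_inequality`: for `m > 2`,
`H_m = |·|^m ∈ C²` with `H_m(0) = 0`, `H_m'' ≥ 0`, `H_m'² ≤ (m/(m−1)) H_m H_m''`, and the signed
square root `s_m = |·|^{m/2−1}·` is `C¹` with `s_m² = H_m`, `2 s_m'² ≤ H_m''` (`SignedPowers`;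
Lei–Zhang 2011, §2 p. 6: "Consider the functions `f = |Γ|^q`").
[cite: LeiZhang2011, §2 (arXiv p. 6), f = |Γ|^q] -/
theorem abs_family :
    (∀ v : ℝ, 0 ≤ |v|) ∧ (Continuous fun v : ℝ => |v|) ∧
    (∀ (m : ℝ) (v : ℝ), 2 < m → |v| ^ m = |v| ^ m) ∧
    (∀ m : ℝ, 2 < m →
      ContDiff ℝ 2 (fun v : ℝ => |v| ^ m) ∧ |(0 : ℝ)| ^ m = 0 ∧
      (∀ v : ℝ, 0 ≤ deriv (deriv fun v : ℝ => |v| ^ m) v) ∧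
      (∀ v : ℝ, deriv (fun v : ℝ => |v| ^ m) v ^ 2 ≤
        m / (m - 1) * (|v| ^ m * deriv (deriv fun v : ℝ => |v| ^ m) v)) ∧
      ContDiff ℝ 1 (fun v : ℝ => |v| ^ (m / 2 - 1) * v) ∧
      (∀ v : ℝ, (|v| ^ (m / 2 - 1) * v) ^ 2 = |v| ^ m) ∧
      (∀ v : ℝ, 2 * deriv (fun v : ℝ => |v| ^ (m / 2 - 1) * v) v ^ 2 ≤
        deriv (deriv fun v : ℝ => |v| ^ m) v)) := by
  refine ⟨fun v => abs_nonneg v, continuous_abs, fun m v _ => rfl, fun m hm => ?_⟩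
  exact ⟨contDiff_two_abs_rpow hm, abs_rpow_zero_of_ne (by linarith),
    deriv_deriv_abs_rpow_nonneg hm, deriv_abs_rpow_sq_le hm,
    contDiff_one_abs_rpow_half_sub_one_mul hm, abs_rpow_half_sub_one_mul_sq (by linarith),
    two_mul_deriv_abs_rpow_half_sq_le hm⟩

/-! ### From `L^∞` bounds to pointwise bounds for continuous functions -/

/-- A function continuous on an open set `U` is pointwise bounded there by its `L^∞(U)` norm,
for a measure charging nonempty open sets (private copy of
`enorm_le_eLpNorm_top_restrict_of_continuousOn`, `ClassicalTopPointRegularity`). [folklore] -/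
private theorem enorm_le_eLpNorm_top_of_continuousOn_aux {X : Type*} [TopologicalSpace X]
    [MeasurableSpace X] [OpensMeasurableSpace X] {μ : Measure X} [μ.IsOpenPosMeasure]
    {U : Set X} (hU : IsOpen U) {g : X → ℝ} (hg : ContinuousOn g U) {x : X} (hx : x ∈ U) :
    ‖g x‖ₑ ≤ eLpNorm g ⊤ (μ.restrict U) := by
  by_contra h
  push Not at h
  set c := eLpNorm g ⊤ (μ.restrict U) with hc
  have hopen : IsOpen (U ∩ g ⁻¹' {z | c < ‖z‖ₑ}) :=
    hg.isOpen_inter_preimage hU (isOpen_lt continuous_const continuous_enorm)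
  have hpos : 0 < μ (U ∩ g ⁻¹' {z | c < ‖z‖ₑ}) := hopen.measure_pos μ ⟨x, hx, h⟩
  have hae : ∀ᵐ y ∂(μ.restrict U), ‖g y‖ₑ ≤ c := by
    rw [hc, eLpNorm_exponent_top]; exact ae_le_eLpNormEssSup
  have hnull : μ.restrict U {y | c < ‖g y‖ₑ} = 0 := by
    rw [ae_iff] at hae
    simpa only [not_le] using hae
  rw [Measure.restrict_apply' hU.measurableSet, inter_comm] at hnull
  exact hpos.ne' hnull

/-- The open parabolic cylinder inside the closed one. [folklore] -/
theorem Ioo_prod_ball_subset_cyl (r : ℝ) :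
    (Ioo (-r ^ 2) 0 ×ˢ ball (0 : EuclideanSpace ℝ (Fin 3)) r : Set (ℝ × EuclideanSpace ℝ (Fin 3))) ⊆
      Ioc (-r ^ 2) 0 ×ˢ closedBall (0 : EuclideanSpace ℝ (Fin 3)) r :=
  prod_mono Ioo_subset_Ioc_self ball_subset_closedBall

/-- A continuous function on `ℝ × ℝ³` is bounded pointwise on the open cylinder
`(−r², 0) × B(0, r)` by its `L^∞` norm on `(−r², 0] × B̄(0, r)`. [folklore] -/
theorem enorm_le_eLpNorm_top_cyl {g : ℝ × EuclideanSpace ℝ (Fin 3) → ℝ} (hg : Continuous g)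
    {r s : ℝ} {x : EuclideanSpace ℝ (Fin 3)} (hs : s ∈ Ioo (-r ^ 2) 0) (hx : x ∈ ball 0 r) :
    ‖g (s, x)‖ₑ ≤ eLpNorm g ⊤ (((volume : Measure ℝ).prod
      (volume : Measure (EuclideanSpace ℝ (Fin 3)))).restrict
        (Ioc (-r ^ 2) 0 ×ˢ closedBall (0 : EuclideanSpace ℝ (Fin 3)) r)) := by
  set μ : Measure (ℝ × EuclideanSpace ℝ (Fin 3)) := (volume : Measure ℝ).prod volume with hμ
  set U : Set (ℝ × EuclideanSpace ℝ (Fin 3)) :=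
    Ioo (-r ^ 2) 0 ×ˢ ball (0 : EuclideanSpace ℝ (Fin 3)) r with hU'
  have hU : IsOpen U := isOpen_Ioo.prod isOpen_ball
  have hmem : ((s, x) : ℝ × EuclideanSpace ℝ (Fin 3)) ∈ U := ⟨hs, hx⟩
  have h1 : ‖g (s, x)‖ₑ ≤ eLpNorm g ⊤ (μ.restrict U) :=
    enorm_le_eLpNorm_top_of_continuousOn_aux (μ := μ) hU hg.continuousOn hmem
  have h2 : eLpNorm g ⊤ (μ.restrict U) ≤ eLpNorm g ⊤ (μ.restrict
      (Ioc (-r ^ 2) 0 ×ˢ closedBall (0 : EuclideanSpace ℝ (Fin 3)) r)) :=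
    eLpNorm_mono_measure g (Measure.restrict_mono (Ioo_prod_ball_subset_cyl r) le_rfl)
  exact h1.trans h2

/-- The closed parabolic cylinder has finite measure. [folklore] -/
theorem volume_cyl_lt_top (a : ℝ) (r : ℝ) :
    ((volume : Measure ℝ).prod (volume : Measure (EuclideanSpace ℝ (Fin 3))))
      (Ioc a 0 ×ˢ closedBall (0 : EuclideanSpace ℝ (Fin 3)) r) < ⊤ := by
  rw [Measure.prod_prod]
  exact ENNReal.mul_lt_top measure_Ioc_lt_top measure_closedBall_lt_top

/-- A continuous function has finite `L^p` norm on the closed parabolic cylinder. [folklore] -/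
theorem eLpNorm_cyl_lt_top {g : ℝ × EuclideanSpace ℝ (Fin 3) → ℝ} (hg : Continuous g)
    (a r : ℝ) (p : ℝ≥0∞) :
    eLpNorm g p (((volume : Measure ℝ).prod (volume : Measure (EuclideanSpace ℝ (Fin 3)))).restrict
      (Ioc a 0 ×ˢ closedBall (0 : EuclideanSpace ℝ (Fin 3)) r)) < ⊤ := by
  haveI : IsFiniteMeasure ((((volume : Measure ℝ).prod
      (volume : Measure (EuclideanSpace ℝ (Fin 3)))).restrict
        (Ioc a 0 ×ˢ closedBall (0 : EuclideanSpace ℝ (Fin 3)) r))) :=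
    isFiniteMeasure_restrict.2 (volume_cyl_lt_top a r).ne
  -- `g` is bounded on the compact closure `[a, 0] × B̄(0, r)`
  have hK : IsCompact (Icc a 0 ×ˢ closedBall (0 : EuclideanSpace ℝ (Fin 3)) r) :=
    isCompact_Icc.prod (isCompact_closedBall _ _)
  obtain ⟨C, hC⟩ := hK.exists_bound_of_continuousOn hg.continuousOn
  refine (MemLp.of_bound hg.aestronglyMeasurable C ?_).eLpNorm_lt_top
  refine (ae_restrict_iff' (measurableSet_Ioc.prod measurableSet_closedBall)).2
    (Eventually.of_forall fun q hq => hC q ⟨Ioc_subset_Icc_self hq.1, hq.2⟩)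

/-! ### The pointwise bound in the setting at radius `ρ` -/

/-- **The local maximum estimate (2.6), pointwise form, in `L^{10/3}`**: for every `BMO` bound
`C_B` there is `C ≥ 0` such that in every setting at radius `ρ` (hypotheses of
`meanValue_inequality_tenThirds`), for `s ∈ (−ρ²/4, 0)` and `x ∈ B(0, ρ/2)`,
`|F(s, x)| ≤ C ρ^{-3/2} ‖F‖_{L^{10/3}((−ρ²,0]×B̄(0,ρ))}` (`meanValue_inequality_tenThirds` for
the family `|·|^m`, and continuity of `F`). [cite: LeiZhang2011, §2 (2.6) (arXiv p. 8)] -/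
theorem abs_le_of_setting_tenThirds (CB : ℝ≥0) :
    ∃ C : ℝ, 0 ≤ C ∧ ∀ ⦃ρ : ℝ⦄, 0 < ρ →
      ∀ ⦃F N : ℝ → EuclideanSpace ℝ (Fin 3) → ℝ⦄
        ⦃b Bst : ℝ → EuclideanSpace ℝ (Fin 3) → EuclideanSpace ℝ (Fin 3)⦄,
      (∀ s, ContDiff ℝ 2 (F s)) → (∀ s, IsAxisymmetricScalar (F s)) →
      (∀ s x, cylRadius x = 0 → F s x = 0) →
      (∀ s, LocallyIntegrable (b s) volume) →
      (∀ᵐ s ∂(volume.restrict (Ioc (-ρ ^ 2) 0)),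
        Differentiable ℝ (Bst s) ∧ curl (Bst s) =ᵐ[volume] b s ∧ eBMOSeminormVec (Bst s) ≤ CB) →
      (∀ s x, N s x =
        (Δ (F s)) x - fderiv ℝ (F s) x (b s x) - 2 / cylRadius x * fderiv ℝ (F s) x (eR x)) →
      (∀ᵐ x ∂(volume : Measure (EuclideanSpace ℝ (Fin 3))),
        IntervalIntegrable (fun s => N s x) volume (-ρ ^ 2) 0 ∧
          ∀ s ∈ Icc (-ρ ^ 2) 0, F s x = F (-ρ ^ 2) x + ∫ τ in (-ρ ^ 2)..s, N τ x) →
      (Continuous fun p : ℝ × EuclideanSpace ℝ (Fin 3) => F p.1 p.2) →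
      (Continuous fun p : ℝ × EuclideanSpace ℝ (Fin 3) => gradient (F p.1) p.2) →
      AEStronglyMeasurable (fun p : ℝ × EuclideanSpace ℝ (Fin 3) => N p.1 p.2)
        ((volume.restrict (Ioc (-ρ ^ 2) 0)).prod volume) →
      Integrable (fun p : ℝ × EuclideanSpace ℝ (Fin 3) => N p.1 p.2)
        ((volume.restrict (Ioc (-ρ ^ 2) 0)).prod (volume.restrict (closedBall 0 ρ))) →
      AEStronglyMeasurable (fun p : ℝ × EuclideanSpace ℝ (Fin 3) => b p.1 p.2)
        ((volume.restrict (Ioc (-ρ ^ 2) 0)).prod volume) →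
      ∀ ⦃Mb : ℝ⦄, (∀ s, ∀ x ∈ closedBall (0 : EuclideanSpace ℝ (Fin 3)) ρ, ‖b s x‖ ≤ Mb) →
      ∀ s ∈ Ioo (-(ρ / 2) ^ 2) (0 : ℝ), ∀ x ∈ ball (0 : EuclideanSpace ℝ (Fin 3)) (ρ / 2),
        |F s x| ≤ C * ρ ^ (-(3 / 2 : ℝ)) *
          (eLpNorm (fun p : ℝ × EuclideanSpace ℝ (Fin 3) => |F p.1 p.2|) (ENNReal.ofReal (10 / 3))
            (((volume : Measure ℝ).prod (volume : Measure (EuclideanSpace ℝ (Fin 3)))).restrict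
              (Ioc (-ρ ^ 2) 0 ×ˢ closedBall (0 : EuclideanSpace ℝ (Fin 3)) ρ))).toReal := by
  obtain ⟨Cmv, hCmv0, hMV⟩ := meanValue_inequality_tenThirds CB
  refine ⟨Cmv, hCmv0, ?_⟩
  intro ρ hρ F N b Bst hF2 hFa hF0 hb hBst hN heq hFc hF1c hNm hNi hbm Mb hbB s hs x hx
  obtain ⟨hw0, hwc, hHw, hfam⟩ := abs_family
  have hMVI := hMV hρ hF2 hFa hF0 hb hBst hN heq hFc hF1c hNm hNi hbm hbB hw0 hwc
    (Hf := fun m v => |v| ^ m) (sf := fun m v => |v| ^ (m / 2 - 1) * v) hHw hfam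
  set μ : Measure (ℝ × EuclideanSpace ℝ (Fin 3)) := (volume : Measure ℝ).prod volume with hμ
  set g : ℝ × EuclideanSpace ℝ (Fin 3) → ℝ := fun p => |F p.1 p.2| with hg
  have hgc : Continuous g := continuous_abs.comp hFc
  -- the `L^{10/3}` norm is finite, so the right-hand side is a real number
  have hfin := eLpNorm_cyl_lt_top hgc (-ρ ^ 2) ρ (ENNReal.ofReal (10 / 3))
  have hrhs : ENNReal.ofReal (Cmv * ρ ^ (-(3 / 2 : ℝ))) *
      eLpNorm g (ENNReal.ofReal (10 / 3)) (μ.restrict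
        (Ioc (-ρ ^ 2) 0 ×ˢ closedBall (0 : EuclideanSpace ℝ (Fin 3)) ρ)) ≠ ⊤ :=
    ENNReal.mul_ne_top ENNReal.ofReal_ne_top hfin.ne
  -- pointwise on the small open cylinder
  have hpt := enorm_le_eLpNorm_top_cyl hgc (r := ρ / 2) hs hx
  have hle := hpt.trans hMVI
  rw [← ofReal_norm, Real.norm_eq_abs] at hle
  have h2 := (ENNReal.ofReal_le_iff_le_toReal hrhs).1 hle
  rw [ENNReal.toReal_mul, ENNReal.toReal_ofReal (by positivity)] at h2
  simpa only [hg, abs_abs] using h2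

/-! ### The pointwise bound on a slab -/

/-- Time shift of `L^p` norms on parabolic cylinders: the norm of `(s, x) ↦ g(s + τ, x)` on
`(−R², 0] × K` is the norm of `g` on `(τ − R², τ] × K`. [folklore] -/
theorem eLpNorm_comp_add_cyl (g : ℝ × EuclideanSpace ℝ (Fin 3) → ℝ) (hg : AEStronglyMeasurable g
      ((volume : Measure ℝ).prod (volume : Measure (EuclideanSpace ℝ (Fin 3)))))
    (τ R : ℝ) (K : Set (EuclideanSpace ℝ (Fin 3))) (hK : MeasurableSet K) (p : ℝ≥0∞) :
    eLpNorm (fun q : ℝ × EuclideanSpace ℝ (Fin 3) => g (q.1 + τ, q.2)) p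
        ((((volume : Measure ℝ).prod (volume : Measure (EuclideanSpace ℝ (Fin 3)))).restrict
          (Ioc (-R ^ 2) 0 ×ˢ K))) =
      eLpNorm g p ((((volume : Measure ℝ).prod
        (volume : Measure (EuclideanSpace ℝ (Fin 3)))).restrict (Ioc (τ - R ^ 2) τ ×ˢ K))) := by
  set μ : Measure (ℝ × EuclideanSpace ℝ (Fin 3)) := (volume : Measure ℝ).prod volume with hμ
  -- the shift `(s, x) ↦ (s + τ, x)` preserves `μ`
  have hsh : MeasurePreserving (fun q : ℝ × EuclideanSpace ℝ (Fin 3) => (q.1 + τ, q.2)) μ μ := by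
    have h := (measurePreserving_add_right (volume : Measure ℝ) τ).prod
      (MeasurePreserving.id (volume : Measure (EuclideanSpace ℝ (Fin 3))))
    exact h
  have hpre : (fun q : ℝ × EuclideanSpace ℝ (Fin 3) => (q.1 + τ, q.2)) ⁻¹'
      (Ioc (τ - R ^ 2) τ ×ˢ K) = Ioc (-R ^ 2) 0 ×ˢ K := by
    ext q
    simp only [mem_preimage, mem_prod, mem_Ioc]
    constructor
    · rintro ⟨⟨h1, h2⟩, h3⟩; exact ⟨⟨by linarith, by linarith⟩, h3⟩
    · rintro ⟨⟨h1, h2⟩, h3⟩; exact ⟨⟨by linarith, by linarith⟩, h3⟩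
  have hres := hsh.restrict_preimage (s := Ioc (τ - R ^ 2) τ ×ˢ K) (measurableSet_Ioc.prod hK)
  rw [hpre] at hres
  have hg' : AEStronglyMeasurable g (μ.restrict (Ioc (τ - R ^ 2) τ ×ˢ K)) :=
    hg.mono_measure Measure.restrict_le_self
  exact eLpNorm_comp_measurePreserving hg' hres

/-- **The local bound on the swirl-type quantity on a slab.** For every `BMO` bound `C_B` there is
`C ≥ 0` such that: whenever `f`, `u`, `B` satisfy the hypotheses of `bundle_of_swirl_setting_slab`
on `[τ − R², τ]` (in particular `f = Γ` for a classical axisymmetric solution with a `BMO` stream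
function there), then for `t ∈ (τ − R²/4, τ)` and `x ∈ B(0, R/2)`,
`|f(t, x)| ≤ C R^{-3/2} ‖f‖_{L^{10/3}((τ−R²,τ]×B̄(0,R))}` — with `C` independent of the size of
`u` (Lei–Zhang 2011, §2 (2.6) at the energy exponent; the replacement, near a singular time, of
"the maximum principle" of the proof of Theorem 1.4, p. 12).
[cite: LeiZhang2011, §2 (2.6) and §4, proof of Thm. 1.4 (arXiv pp. 8, 12)] -/
theorem abs_le_of_slab (CB : ℝ≥0) :
    ∃ C : ℝ, 0 ≤ C ∧ ∀ ⦃τ R : ℝ⦄, 0 < R →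
      ∀ ⦃f : ℝ → EuclideanSpace ℝ (Fin 3) → ℝ⦄
        ⦃u : ℝ → EuclideanSpace ℝ (Fin 3) → EuclideanSpace ℝ (Fin 3)⦄
        ⦃B : ℝ → EuclideanSpace ℝ (Fin 3) → EuclideanSpace ℝ (Fin 3)⦄ ⦃Cu : ℝ⦄,
      (∀ t ∈ Icc (τ - R ^ 2) τ, ContDiff ℝ 2 (f t)) →
      ContinuousOn (fun p : ℝ × EuclideanSpace ℝ (Fin 3) => f p.1 p.2) (Icc (τ - R ^ 2) τ ×ˢ univ) →
      ContinuousOn (fun p : ℝ × EuclideanSpace ℝ (Fin 3) => fderiv ℝ (f p.1) p.2)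
        (Icc (τ - R ^ 2) τ ×ˢ univ) →
      ContinuousOn (fun p : ℝ × EuclideanSpace ℝ (Fin 3) => (Δ (f p.1)) p.2)
        (Icc (τ - R ^ 2) τ ×ˢ univ) →
      (∀ t ∈ Icc (τ - R ^ 2) τ, IsAxisymmetricScalar (f t)) →
      (∀ t ∈ Icc (τ - R ^ 2) τ, ∀ x, cylRadius x = 0 → f t x = 0) →
      ContinuousOn (uncurry u) (Icc (τ - R ^ 2) τ ×ˢ univ) →
      (∀ t ∈ Icc (τ - R ^ 2) τ, ∀ x, ‖u t x‖ ≤ Cu) →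
      (∀ᵐ t ∂((volume : Measure ℝ).restrict (Icc (τ - R ^ 2) τ)),
        Differentiable ℝ (B t) ∧ curl (B t) =ᵐ[volume] u t ∧ eBMOSeminormVec (B t) ≤ CB) →
      (∀ x, cylRadius x ≠ 0 → ∀ s t : ℝ, τ - R ^ 2 ≤ s → s ≤ t → t ≤ τ →
        f t x - f s x = ∫ σ in s..t, ((Δ (f σ)) x - fderiv ℝ (f σ) x (u σ x) -
          2 / cylRadius x * partialDeriv (eR x) (f σ) x)) →
      ∀ t ∈ Ioo (τ - (R / 2) ^ 2) τ, ∀ x ∈ ball (0 : EuclideanSpace ℝ (Fin 3)) (R / 2),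
        |f t x| ≤ C * R ^ (-(3 / 2 : ℝ)) *
          (eLpNorm (fun p : ℝ × EuclideanSpace ℝ (Fin 3) => |f p.1 p.2|) (ENNReal.ofReal (10 / 3))
            (((volume : Measure ℝ).prod (volume : Measure (EuclideanSpace ℝ (Fin 3)))).restrict
              (Ioc (τ - R ^ 2) τ ×ˢ closedBall (0 : EuclideanSpace ℝ (Fin 3)) R))).toReal := by
  obtain ⟨C, hC0, hC⟩ := abs_le_of_setting_tenThirds CB
  refine ⟨C, hC0, ?_⟩
  intro τ R hR f u B Cu h1 hfc h2 h3 h4 h5 h7 hub hB h11 t ht x hx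
  obtain ⟨F, N, b, Bst, Mb, hFf, hF2, hFa, hF0, hb, hBst, hN, heq, hFc, hF1c, hNm, hNi, hbm, hbB⟩ :=
    bundle_of_swirl_setting_slab hR h1 hfc h2 h3 h4 h5 h7 hub hB h11
  -- the bound for `F` at the shifted time `t − τ`
  have hs : t - τ ∈ Ioo (-(R / 2) ^ 2) (0 : ℝ) := ⟨by linarith [ht.1], by linarith [ht.2]⟩
  have hmain := hC hR hF2 hFa hF0 hb hBst hN heq hFc hF1c hNm hNi hbm hbB (t - τ) hs x hx
  have hsI : t - τ ∈ Icc (-R ^ 2) (0 : ℝ) := ⟨by nlinarith [hs.1, hR], hs.2.le⟩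
  rw [hFf (t - τ) hsI x, sub_add_cancel] at hmain
  refine hmain.trans (le_of_eq ?_)
  congr 2
  -- the `L^{10/3}` norms agree: `|F| = |f(· + τ, ·)|` a.e. on the cylinder, then shift
  set μ : Measure (ℝ × EuclideanSpace ℝ (Fin 3)) := (volume : Measure ℝ).prod volume with hμ
  have hae : (fun p : ℝ × EuclideanSpace ℝ (Fin 3) => |F p.1 p.2|) =ᵐ[μ.restrict
      (Ioc (-R ^ 2) 0 ×ˢ closedBall (0 : EuclideanSpace ℝ (Fin 3)) R)]
        fun p => |f (p.1 + τ) p.2| := by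
    refine (ae_restrict_iff' (measurableSet_Ioc.prod measurableSet_closedBall)).2
      (Eventually.of_forall fun p hp => ?_)
    show |F p.1 p.2| = |f (p.1 + τ) p.2|
    rw [hFf p.1 ⟨hp.1.1.le, hp.1.2⟩ p.2]
  rw [eLpNorm_congr_ae hae]
  -- `(s, x) ↦ |f(s, x)|` is a.e.-strongly measurable on `μ`: it is continuous on the slab, and we
  -- only need it through the shift lemma on the restricted measure; use the clamped
  -- continuous representative `(s, x) ↦ |f(max (τ − R²) (min s τ), x)|`
  set gcl : ℝ × EuclideanSpace ℝ (Fin 3) → ℝ := fun p => |f (max (τ - R ^ 2) (min p.1 τ)) p.2|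
    with hgcl
  have hgclc : Continuous gcl := by
    have hcl : Continuous fun s : ℝ => max (τ - R ^ 2) (min s τ) :=
      continuous_const.max (continuous_id.min continuous_const)
    have hmem : ∀ p : ℝ × EuclideanSpace ℝ (Fin 3),
        ((max (τ - R ^ 2) (min p.1 τ), p.2) : ℝ × EuclideanSpace ℝ (Fin 3)) ∈
          Icc (τ - R ^ 2) τ ×ˢ (univ : Set (EuclideanSpace ℝ (Fin 3))) := fun p =>
      ⟨⟨le_max_left _ _, max_le (by nlinarith) (min_le_right _ _)⟩, mem_univ _⟩
    have h := hfc.comp_continuous ((hcl.comp continuous_fst).prodMk continuous_snd) hmem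
    exact continuous_abs.comp h
  have hcl_eq : ∀ s ∈ Ioc (τ - R ^ 2) τ, max (τ - R ^ 2) (min s τ) = s := fun s hs => by
    rw [min_eq_left hs.2, max_eq_right hs.1.le]
  -- replace `|f|` by `gcl` on both cylinders
  have hae1 : (fun p : ℝ × EuclideanSpace ℝ (Fin 3) => |f (p.1 + τ) p.2|) =ᵐ[μ.restrict
      (Ioc (-R ^ 2) 0 ×ˢ closedBall (0 : EuclideanSpace ℝ (Fin 3)) R)]
        fun p => gcl (p.1 + τ, p.2) := by
    refine (ae_restrict_iff' (measurableSet_Ioc.prod measurableSet_closedBall)).2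
      (Eventually.of_forall fun p hp => ?_)
    show |f (p.1 + τ) p.2| = |f (max (τ - R ^ 2) (min (p.1 + τ) τ)) p.2|
    rw [hcl_eq (p.1 + τ) ⟨by linarith [hp.1.1], by linarith [hp.1.2]⟩]
  have hae2 : (fun p : ℝ × EuclideanSpace ℝ (Fin 3) => |f p.1 p.2|) =ᵐ[μ.restrict
      (Ioc (τ - R ^ 2) τ ×ˢ closedBall (0 : EuclideanSpace ℝ (Fin 3)) R)] gcl := by
    refine (ae_restrict_iff' (measurableSet_Ioc.prod measurableSet_closedBall)).2
      (Eventually.of_forall fun p hp => ?_)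
    show |f p.1 p.2| = |f (max (τ - R ^ 2) (min p.1 τ)) p.2|
    rw [hcl_eq p.1 hp.1]
  rw [eLpNorm_congr_ae hae1, eLpNorm_congr_ae hae2]
  exact eLpNorm_comp_add_cyl gcl hgclc.aestronglyMeasurable τ R _ measurableSet_closedBall _

end LeiZhang2011

end Literature.Analysis.FluidPDE
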